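import Literature.MathematicalPhysics.QuantumFieldTheory.ConformalBootstrap3D.PointKernelK34v2Data
import Literature.MathematicalPhysics.QuantumFieldTheory.ConformalBootstrap3D.PointKernelParts

/-!
# K34v2 certificate, kernel part file P26: one-cell head segments 143, 144 in level ranges

The head cells whose kernel evaluation exceeds one `decide` are one-cell segments of `hsegsK34v2`; each is
checked by `PCert.hPartSideOK` (side conditions) and `PCert.hPartOK` per level range `[n_lo, n_lo + count)`
against an integer claim, the claims summing to `≥ 0` (`PointKernel.partsOK`); soundness is
`PCert.hParts_sound` (`PointKernelParts`).  The part files `P1, P2, …` are mutually independent (each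
imports only the data file); the ranges of one cell may span several of them, and the per-cell
conclusions `hparts_i` / `hcell_i` of those cells are assembled in `PointKernelK34v2.lean`.
Estimated kernel time 233 s.
-/

set_option maxRecDepth 100000
set_option maxHeartbeats 0

namespace Literature.MathematicalPhysics.QuantumFieldTheory.ConformalBootstrap3D.PointKernelK34v2

open Literature.MathematicalPhysics.QuantumFieldTheory.ConformalBootstrap3D.PointKernel

/-- levels `[60, 64)` of segment 143: partial lower sum `≥` claim. [folklore] -/
theorem part_143_6 : certK34v2.hPartOK (PCert.segAt hsegsK34v2 143) JHK34v2 60 4 (391593357361076676435127329106264901) = true := by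
  decide +kernel

/-- levels `[64, 68)` of segment 143: partial lower sum `≥` claim. [folklore] -/
theorem part_143_7 : certK34v2.hPartOK (PCert.segAt hsegsK34v2 143) JHK34v2 64 4 (238342721555833724961765372386834224) = true := by
  decide +kernel

/-- levels `[68, 71)` of segment 143: partial lower sum `≥` claim. [folklore] -/
theorem part_143_8 : certK34v2.hPartOK (PCert.segAt hsegsK34v2 143) JHK34v2 68 3 (103904827354371853861320071694288693) = true := by
  decide +kernel

/-- levels `[71, 73)` of segment 143: partial lower sum `≥` claim. [folklore] -/
theorem part_143_9 : certK34v2.hPartOK (PCert.segAt hsegsK34v2 143) JHK34v2 71 2 (35727959653912963588630368848019848) = true := by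
  decide +kernel

/-- one-cell segment 144 (row 6, cell `[28677/4096, 14339/2048]`, chord, `n_F = 64`,
6 level ranges): side conditions. [folklore] -/
theorem pside_144 : certK34v2.hPartSideOK (PCert.segAt hsegsK34v2 144) JHK34v2 = true := by
  decide +kernel

/-- its level ranges `(n_lo, count, claim)`. [folklore] -/
def parts_144 : List (ℕ × ℕ × ℤ) := [(0, 28, -33810395543026929569149764007957480939), (28, 12, 23837486077091367037627586149567107244), (40, 9, 6641738705248816713076750244656875435), (49, 7, 2164487870541855407238234896969069508), (56, 5, 787383704576434049180532676658360995), (61, 4, 379299185568456362026660040106067760)]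

/-- the ranges tile `[0, n_F]` and the claims sum to `≥ 0`. [folklore] -/
theorem pcov_144 : PointKernel.partsOK 64 parts_144 = true := by
  decide +kernel

end Literature.MathematicalPhysics.QuantumFieldTheory.ConformalBootstrap3D.PointKernelK34v2
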